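import Mathlib
import HarnessLib

/-!
# Line `taylor-model` on crux K1b-DR (stmt-NavierStokesRegularity-23954) — stub G4 (`LandingC1`),
# helper 5: a derivative bound from an increment bound (limits of slopes)

Toward the registered stub `stub_landing : LandingC1`. A generic one-variable calculus lemma used by the
rP-unit frame transport of G-PROOFPLAN §3: if two curves `A, B : ℝ → (Fin n → ℝ)` have derivatives `A', B'`
within `[0,1]` at `σ`, and near `σ` (within `[0,1]`) the increments satisfy, coordinatewise,
`|(A σ' − A σ − L (B σ' − B σ)) c| ≤ K c · N (B σ' − B σ)` for a continuous linear `L`, a continuous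
absolutely homogeneous gauge `N` and constants `K c`, then `|(A' − L B') c| ≤ K c · N B'` (divide by
`|σ' − σ|` and pass to the limit along `𝓝[[0,1] \ {σ}] σ`, which is non-trivial). Also: positivity of the
defect `1/(1−q')² − 1/(1−q)²` for `q ≤ q' < 1`.

MODEL-lattice bookkeeping only (rung TL-M3); nothing here is a statement about the Navier–Stokes equations.
-/

noncomputable section

-- the sub-problem namespace repeats the summit name by design (D-0017)
set_option linter.dupNamespace false

namespace Summit.NavierStokesRegularity.NavierStokesRegularity.Theorems.TaylorModelReadout.G4

open Set Filter Topology

/-- The punctured neighbourhood filter of a point of `[0,1]` within `[0,1]` is non-trivial. [folklore] -/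
theorem nhdsWithin_Icc_diff_neBot {σ : ℝ} (hσ : σ ∈ Icc (0:ℝ) 1) : (𝓝[Icc (0:ℝ) 1 \ {σ}] σ).NeBot := by
  rcases lt_or_ge σ 1 with h | h
  · have h1 : (𝓝[Ioo σ 1] σ).NeBot := by rw [nhdsWithin_Ioo_eq_nhdsGT h]; infer_instance
    refine h1.mono (nhdsWithin_mono σ fun x hx => ⟨⟨hσ.1.trans hx.1.le, hx.2.le⟩, ?_⟩)
    exact fun hxs => (ne_of_gt hx.1) hxs
  · have hσ1 : σ = 1 := le_antisymm hσ.2 h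
    subst hσ1
    have h1 : (𝓝[Ioo (0:ℝ) 1] (1:ℝ)).NeBot := by rw [nhdsWithin_Ioo_eq_nhdsLT zero_lt_one]; infer_instance
    refine h1.mono (nhdsWithin_mono (1:ℝ) fun x hx => ⟨⟨hx.1.le, hx.2.le⟩, ?_⟩)
    exact fun hxs => (ne_of_lt hx.2) hxs

/-- **Derivative bound from an increment bound.** See the module docstring. [folklore] -/
theorem deriv_bound_of_increment_bound {n : ℕ} {A B : ℝ → (Fin n → ℝ)} {A' B' : Fin n → ℝ} {σ : ℝ}
    (hσ : σ ∈ Icc (0:ℝ) 1) (hA : HasDerivWithinAt A A' (Icc 0 1) σ) (hB : HasDerivWithinAt B B' (Icc 0 1) σ)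
    (L : (Fin n → ℝ) →L[ℝ] (Fin n → ℝ)) {N : (Fin n → ℝ) → ℝ} (hN : Continuous N)
    (hNs : ∀ (a : ℝ) (x : Fin n → ℝ), N (a • x) = |a| * N x) (K : Fin n → ℝ)
    (h : ∀ᶠ σ' in 𝓝[Icc (0:ℝ) 1] σ, ∀ c, |(A σ' - A σ - L (B σ' - B σ)) c| ≤ K c * N (B σ' - B σ)) :
    ∀ c, |(A' - L B') c| ≤ K c * N B' := by
  intro c
  haveI := nhdsWithin_Icc_diff_neBot hσ
  set F : Filter ℝ := 𝓝[Icc (0:ℝ) 1 \ {σ}] σ with hFdef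
  have hA' : Tendsto (slope A σ) F (𝓝 A') := hasDerivWithinAt_iff_tendsto_slope.1 hA
  have hB' : Tendsto (slope B σ) F (𝓝 B') := hasDerivWithinAt_iff_tendsto_slope.1 hB
  -- left-hand side tends to `|(A' - L B') c|`
  have hl : Tendsto (fun σ' => |(slope A σ σ' - L (slope B σ σ')) c|) F (𝓝 |(A' - L B') c|) := by
    have h1 : Tendsto (fun σ' => slope A σ σ' - L (slope B σ σ')) F (𝓝 (A' - L B')) :=
      hA'.sub ((L.continuous.tendsto _).comp hB')
    exact (((continuous_apply c).tendsto _).comp h1).abs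
  -- right-hand side tends to `K c * N B'`
  have hr : Tendsto (fun σ' => K c * N (slope B σ σ')) F (𝓝 (K c * N B')) :=
    ((hN.tendsto _).comp hB').const_mul _
  -- the inequality holds eventually along `F`
  have hF_le : F ≤ 𝓝[Icc (0:ℝ) 1] σ := nhdsWithin_mono σ fun x hx => hx.1
  have hmem : ∀ᶠ σ' in F, σ' ∈ Icc (0:ℝ) 1 \ {σ} := self_mem_nhdsWithin
  have hev : ∀ᶠ σ' in F, |(slope A σ σ' - L (slope B σ σ')) c| ≤ K c * N (slope B σ σ') := by
    filter_upwards [hF_le h, hmem] with σ' h1 h2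
    have hne : σ' - σ ≠ 0 := sub_ne_zero.2 h2.2
    have e1 : slope A σ σ' - L (slope B σ σ') = (σ' - σ)⁻¹ • (A σ' - A σ - L (B σ' - B σ)) := by
      simp only [slope_def_module, map_sub, map_smul, smul_sub]
    rw [e1, slope_def_module, hNs, Pi.smul_apply, smul_eq_mul, abs_mul, abs_inv]
    have hpos : 0 < |σ' - σ|⁻¹ := inv_pos.2 (abs_pos.2 hne)
    calc |σ' - σ|⁻¹ * |(A σ' - A σ - L (B σ' - B σ)) c| ≤ |σ' - σ|⁻¹ * (K c * N (B σ' - B σ)) :=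
          mul_le_mul_of_nonneg_left (h1 c) hpos.le
      _ = K c * (|σ' - σ|⁻¹ * N (B σ' - B σ)) := by ring
  exact le_of_tendsto_of_tendsto hl hr hev

/-- Positivity of the defect `1/(1−q')² − 1/(1−q)²` for `q ≤ q' < 1`. [folklore] -/
theorem defect_nonneg {q q' : ℝ} (hqq : q ≤ q') (hq' : q' < 1) :
    0 ≤ 1 / (1 - q') ^ 2 - 1 / (1 - q) ^ 2 := by
  have h1 : 0 < 1 - q' := by linarith
  have h0 : 0 ≤ 1 - q' := h1.le
  have hq1 : 0 ≤ 1 - q := by linarith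
  have h2 : (1 - q') ^ 2 ≤ (1 - q) ^ 2 := pow_le_pow_left₀ h0 (by linarith) 2
  have h3 : 0 < (1 - q') ^ 2 := by positivity
  have := one_div_le_one_div_of_le h3 h2
  linarith

/-- Monotonicity of `1/(1 − a t)²` in `t ∈ [0, T]` for `a ≥ 0`, `a T < 1`. [folklore] -/
theorem one_div_sq_mono {a t T : ℝ} (ha : 0 ≤ a) (ht : 0 ≤ t) (htT : t ≤ T) (hg : a * T < 1) :
    1 / (1 - a * t) ^ 2 ≤ 1 / (1 - a * T) ^ 2 := by
  have h1 : 0 < 1 - a * T := by linarith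
  have h3 : a * t ≤ a * T := mul_le_mul_of_nonneg_left htT ha
  have h4 : 0 ≤ a * t := mul_nonneg ha ht
  have h2 : (1 - a * T) ^ 2 ≤ (1 - a * t) ^ 2 := by nlinarith
  exact one_div_le_one_div_of_le (by positivity) h2

/-- `0 ≤ 1/(1 − a t)²`. [folklore] -/
theorem one_div_sq_nonneg (x : ℝ) : 0 ≤ 1 / (1 - x) ^ 2 := by positivity

end Summit.NavierStokesRegularity.NavierStokesRegularity.Theorems.TaylorModelReadout.G4

end
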